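import Mathlib
import HarnessLib
import HarnessLib.Audit
import Summits.QuantumAdvantage.Statement
import Literature.Computability.Cryptography.ClassBQP
import Literature.Computability.Complexity.Randomized
import Literature.Computability.Complexity.BoolEncodings
import Literature.Computability.Complexity.Oracle
import Literature.Computability.Complexity.Promise
import HarnessLib.Audit.Status.Attr

/-!
Route: CodeCarries

Route CodeCarries (realises idea card QuantumAdvantage/QuantumAdvantage/code-carries-the-summit).
THESIS X (words): the OPTIMAL POLYNOMIAL INTERSECTION relation at the
Jordan-Shutty-Wootters-Zalcman-Schmidhuber-King-Isakov-Babbush parameters (arXiv:2408.08292 Def 2.2,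
s5: p prime, m = p-1 constraints, allowed sets |F_y| = floor(p/2), n = ceil(p/10) coefficients,
threshold 7/10 of the constraints; DQI+Berlekamp-Massey achieves 0.7179, best known classical 0.55 =
Prange) -- a TOTAL, P-CHECKABLE relation solved by a quantum polynomial-time algorithm by a THEOREM
-- is solvable by a classical probabilistic polynomial-time machine with oracle access to some
PromiseBQP problem (OpiLiftPromise) but by no PPT machine alone (OpiHard). Hence PromiseBQP ⊄
PromiseBPP' (textbook prBPP), and with the shared promise->language lift PL (PromiseLift stmt-0250)
the summit. "A code carries the summit": the first promise-separation source whose quantum half is a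
theorem and whose classical half is coding-theoretic (noisy polynomial reconstruction / list
recovery), neither number-theoretic nor Forrelation/permanent-type.
Lean (one line each, existing decls only, rc 0): X := OpiHard ∧ OpiLiftPromise where
 OpiHard := ¬ ∃ A : Literature.Computability.Complexity.RandAlg (ℕ × List (List ℕ)) (List ℕ),
A.IsPolyTime encI encQ ∧ ∃ P₀, ∀ p F, Valid P₀ p F → 2/3 ≤ A.pr encI (p,F) {cs | Good p F cs};
 OpiLiftPromise := ∃ Q ∈ Literature.Computability.Cryptography.PromiseBQP, ∃ M :
Literature.Computability.Complexity.OracleAlg (List ℕ), M.IsPolyTime encodingListNatBool ∧ ∃ q k P₀,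
∀ O : Oracle, (O = [true] on Q.yes) → (O = [false] on Q.no) → ∀ p F, Valid P₀ p F → 2/3 ≤
uniformProb (k |x|) {r | M.run O (q |x|) (boolPair x r) = some cs with Good p F cs, queries ≤ q
|x|};
 with Valid P₀ p F := p.Prime ∧ P₀ ≤ p ∧ F.length = p-1 ∧ ∀ S ∈ F, S.Nodup ∧ S.length = p/2 ∧ ∀ v ∈
S, v < p; Good p F cs := cs.length = (p+9)/10 ∧ (∀ a ∈ cs, a < p) ∧ 7(p-1) ≤ 10·#{j < p-1 : (Σ_i
cs[i](j+1)^i) mod p ∈ F[j]}; encI p F := boolPair (encodeNat p) (encodingListNatBool.listBool.encode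
F) -- all spelled out inline in the filed signatures.
IT SUFFICES: Assembly := OpiHard → OpiLiftPromise → OpiGlue → PlLift → QuantumAdvantage, where
OpiGlue := OpiHard → OpiLiftPromise → ¬(PromiseBQP ⊆ PromiseBPP') (support: simulate the promise
oracle by an amplified, memoised prBPP decider; lazy-sampling over off-promise answers) and PlLift
:= BQP ⊆ BPP → PromiseBQP ⊆ PromiseBPP' (shared crux); the last step is contraposition + classical
logic (checked rc 0 with an explicit proof term in the sketch). PL-free twin: OpiGlueLang := OpiHard
→ OpiLiftLang → QuantumAdvantage with the oracle a BQP LANGUAGE (crux OpiLiftLang).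

Rationale: WHY THIS LINE. Decoded Quantum Interferometry (JSW+ arXiv:2408.08292, Nature 646 (2025), Thm 4.1
semicircle law; s5 OPI via Reed-Solomon duals + Berlekamp-Massey) gives a search advantage whose
QUANTUM half is a theorem and whose classical half is an open coding-theory challenge (0.7179 vs
0.55; Kramer-Schubert-Eisert arXiv:2603.04540: r/q+eps NP-hard worst case; Gil-Fuster et al.
arXiv:2607.28120 (Jul 2026): MCMC matches DQI only in time ~1.1^n, do 'not refute' the claim;
Horinaga-Yamakawa arXiv:2607.14650 (Jul 2026): even exact solutions quantumly for rate > 0.75). DQI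
is not pseudo-deterministic and its law has no heavy outputs and is samplable in BPP^NP
(Marwaha-Fefferman-Gheorghiu-Havlicek arXiv:2509.14443), so NO supremacy/PH argument can ever
connect it to S; and the DECISION version of OPI is classically easy (arXiv:2607.28120 Thm 2-3:
moments binomial below the dual distance). The only road from this advantage to the summit is
therefore a classical decision-to-search that consults quantum DECISIONS about other promise
problems: X = OpiHard ∧ OpiLiftPromise. Either answer to the lift is a theorem worth having: YES
gives the hub a third, independent source of PromiseBQP != PromiseBPP' (after Forrelation-type and
permanent-type) resting on Naor-Pinkas-type hardness; NO (in the instance form) refutes white-box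
search-to-decision (QSD of card search-to-decision-lift) on the friendliest possible relation --
total, checkable, theorem-grade quantum solver. Imported area: algebraic coding theory (RS
shortening/list decoding: conditioning the DQI law on a top coefficient IS the DQI law of the
shortened instance with the same P, so unique-decoding 'steering depth' is n+1-2l in {0,1} at the
advantage point while Guruswami-Sudan list radius m-sqrt(mk) buys depth Theta(l^2/n) -- the attack
on the crux).
RANKED CRUXES (all signatures elaborate, rc 0).
 rank 2 OpiLiftPromise [crux, two-sided]: R_OPI(7/10) ∈ FBPP^{PromiseBQP} (for EVERY oracle
consistent with the promise). Why it might fail: (a)-side needs a descent surviving steering depth 0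
-- conditioned laws are DQI laws of shortened instances whose mass on non-decodable syndromes the
semicircle analysis does not control; Gil-Fuster et al. App. D2 record the same obstruction
informally; (b)-side (a proof of the negation) needs a lower bound against adaptive classical use of
quantum acceptance probabilities, provable only in restricted forms. Sources: arXiv:2408.08292 s5,
arXiv:2607.28120 App D2, Guruswami-Sudan 1999, Koetter-Vardy 2003, arXiv:2411.12553,
Bellare-Goldwasser 1994.
 rank 3 OpiQSolvable [crux, theorem-target, the missing named fact]: exists P0, IsQSolvable
R_OPI(7/10) for p >= P0 (JSW Thm 4.1 + finite-size s8 + BM decoder + Markov + parallel repetition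
with classical selection inside one uniform Clifford+T family). Why it might fail as typed:
finite-size corrections and the l <= (n-1)/2 constraint must still clear 0.70 (asymptote 0.7179);
reversible BM and QFT over F_p^n inside Clifford+T; all-wires measurement convention (prefix encQ
cs). Sources: arXiv:2408.08292 Thm 4.1, s8, s5; arXiv:2504.18334 (circuits); arXiv:2601.15171.
 rank 4 OpiHard [crux, hypothesis-type]: no PPT reaches 7/10 on all large valid instances. Why it
might fail: a classical polynomial-time 0.7-algorithm (JSW's open challenge; lattice/BN00 and
list-decoding attacks fail in this regime per arXiv:2408.08292 s11; MCMC is 1.1^n empirically) -- no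
reduction from a standard assumption is known (JSW Rem 5.2). Sources: arXiv:2408.08292 Rem 5.2 +
s11, Naor-Pinkas 1999/2006, Bleichenbacher-Nguyen 2000, arXiv:2607.28120, arXiv:2603.04540.
 rank 5 PlLift [crux, shared stmt-0250]: as in PromiseLift. rank 6 OpiLiftLang [crux]: PL-free
variant with a BQP LANGUAGE oracle (harder to exhibit: natural branch tests are gapped promise
problems). Supports: OpiGlue, OpiGlueLang (provable now, PPT plumbing). Assembly rank 1.
KILL CRITERIA. Classical poly-time 0.7-algorithm for OPI (kills OpiHard and the card); a proof that
every FBPP^{PromiseBQP} algorithm for OPI can be replaced by one querying only OPI-decision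
instances (then arXiv:2607.28120 Thm 2 makes the lift useless and OpiLiftPromise collapses to
OpiHard's negation) -> close refuted; OpiLiftPromise refuted in instance form -> route closes but
files the first white-box counterexample to checkable QSD (negative knowledge for
search-to-decision-lift, steer-or-pay-entropy).
NOT DECOMPOSED YET. The shortening identity and steering depth (prover-level lemmas under
OpiLiftPromise, --supports); list-decoding descent as a candidate M; the exact-threshold variant via
Horinaga-Yamakawa (stronger quantum half, weaker hypothesis); FBPP-with-promise-oracle as a named
class (definition request filed); kit numerics at p in {11,13} (conditioned DQI laws vs
shortened-instance laws) recommended by the audit as the cheapest probe.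

Novelty: NOVELTY (searched 2026-08-15, this planner: `lit search --source arxiv "decoded quantum
interferometry"` 25 rows all screened; READ arXiv:2408.08292 pp.5-6,10-12,35 (Def 2.2, Thm 4.1, s5
parameters, Rem 5.2, s11 lattice attacks); READ arXiv:2607.28120 pp.1-7
(Gil-Fuster-Ninio-Bittel-Shimoni-Eisert-Woerner-Carrera Vazquez, 31 Jul 2026); READ arXiv:2607.14650
pp.1-3 (Horinaga-Yamakawa, 16 Jul 2026); `lit frontier QuantumAdvantage --since 2022` (row 6
arXiv:2602.17647 pseudo-deterministic algorithms = the pd-obstruction); card audit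
refuter-novelty-audit-11 READ arXiv:2509.14443 pp.1-3,129-131 and arXiv:2408.08292 pp.5-6,11,46;
hub: PromiseLift items 0248/0250, cards search-to-decision-lift, steer-or-pay-entropy,
summit-is-pseudo-deterministic).
Nearest prior art: (1) arXiv:2509.14443 (MFGH: DQI sampling in BPP^NP, no heavy outputs, 'it remains
open whether DQI admits a rigorous separation'; no search-to-decision); (2) arXiv:2607.28120 Thm 2-3
+ App D2 (NEW since the card: decision version classically easy below the dual distance; an informal
'obstruction against the standard reduction from search to decision' for DQI = the card's
conditioning lemma L2 in words; MCMC ~1.1^n) -- the closest print statement of the obstruction, not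
of the lift; (3) arXiv:2607.14650 / Sun-Wootters / Chailloux 2025 (quantum and existential
improvements of the OPI regime; quantum side only); (4) Aaronson arXiv:1009.5104 (FBQP = FBPP iff
SampBQP = SampBPP) and Aaronson-Gur-Li arXiv:2602.17647 (pseudo-d  [refs: 2408.08292, 2607.28120, 2607.14650, 2602.17647, 2509.14443, 1009.5104]

Barriers (technique_class: conditional-bridge, search-to-decision, coding-theory): Literature.Barriers.QuantumAdvantage.SeparationPrerequisites: APPLIES at the top (via PL the
conclusion is the summit => PP ⊄ BPP, P != PSPACE; OpiHard alone => NP ⊄ BPP since R_OPI is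
TFNP-type); NOT evaded -- OpiHard is hypothesis-type and PL is open; earned content = OpiQSolvable,
the glue lemmas, and a decision of the lift either way.
Literature.Barriers.QuantumAdvantage.TotalFunctionSpeedupLimit: consistent and informative -- R_OPI
is a total RELATION with explicit (white-box) input, not a total Boolean function of an oracle;
Beals et al. / Aaronson-Gur-Li pseudo-determinism bounds are exactly why DQI cannot be made
canonical black-box, and the steering obstruction is the white-box face of that; the route never
claims a total-function speedup.
Literature.Barriers.QuantumAdvantage.RandomOracleMethod: n/a -- OPI is oracle-free and maximally
structured (Reed-Solomon); AA14's conjecture says nothing about it (the point of moving the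
search-to-decision test white-box).
Literature.Barriers.QuantumAdvantage.SupremacyTheoremsNonRelativizing: consistent -- MFGH's BPP^NP
sampler (arXiv:2509.14443) shows no PH-collapse supremacy argument exists for DQI and the route uses
none.
Literature.Barriers.QuantumAdvantage.Relativization /
Literature.Barriers.QuantumAdvantage.Algebrization: PL and any proof of OpiLiftPromise's negation
are non-relativizing targets (PSPACE oracle collapses promise classes too); OpiGlue/OpiGlueLang are
oracle-SIMULATION lemmas that relativize harmlessly; OpiHa

History (route lifecycle, newest last):
- 2026-08-24T11:50:57Z · DORMANT — reconciler: no traction for 6.7 d (last activity item-evidence-added at 2026-08-17T17:20:32Z); parked, not closed — `ledger route dormant route-QuantumAdvantage (operator:999:3780359)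
- 2026-08-29T10:34:12Z · REACTIVATED — reconciler: reactivated — activity statement-checked at 2026-08-29T09:00:29Z after parking at 2026-08-24T11:50:57Z (operator:999:2694225)

sub-problem: QuantumAdvantage · status: open · opened planner-plancards-QuantumAdvantage-QuantumAdvantage-20260815w1-1-0 2026-08-15T10:38:56Z · rev 2 · ledger route-QuantumAdvantage-CodeCarries
GENERATED by the gate from the ledger (D-0016/17). Provers cite these decls: `theorem foo : Summit.QuantumAdvantage.QuantumAdvantage.Theses.CodeCarries.<Decl> := …` in Summits/QuantumAdvantage/QuantumAdvantage/Theorems/<Name>.lean.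
-/

namespace Summit.QuantumAdvantage.QuantumAdvantage.Theses.CodeCarries

open scoped BigOperators Topology Manifold Classical MeasureTheory ProbabilityTheory Matrix InnerProductSpace ComplexConjugate ContinuousMap
open Filter Set Function TopologicalSpace MeasureTheory

attribute [summit_statement] _root_.QuantumAdvantage

open Literature.QuantumAdvantage

/-- item stmt-QuantumAdvantage-0993 · crux · rank 2 · open · by planner
why it might fail: YES side: prefix-conditioned DQI laws = laws of SHORTENED RS instances whose decoding radius drops per fixed symbol (steering depth <=1 at l=n/2): standard search-to-decision breaks (Gil-Fuster+ App D2); prBQP=prBPP => FBQP=FBPP open (Aaronson 2011). NO side: no lower-bound tool vs adaptive queries.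
sources: arXiv:2607.28120 App D2 pp.21-22 (obstacles against the standard reduction from search to decision for DQI/max-LINSAT) + Sec IV.B p.7, arXiv:1009.5104 Sec 1 p.4 (SampP=SampBQP => FBPP=FBQP => PromiseBPP=PromiseBQP => BPP=BQP; converses open) + Sec 4.1 p.11 (equivalence of search and decision/promise problems left open), arXiv:2408.08292 Sec 5 p.11 (RS dual [p-1,p-n-1,n+1], BM to half distance, 0.7179 vs Prange 0.55), Guruswami-Sudan IEEE-IT 45 (1999) / Koetter-Vardy IEEE-IT 49 (2003) (list radius m-sqrt(mk): the candidate descent)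
[crux] THE INSTANCE LIFT (card D3, two-sided): R_OPI(7/10) ∈ FBPP^{PromiseBQP} — there are a promise
problem Q ∈ PromiseBQP and a polynomial-time oracle algorithm M (transcript model OracleAlg, coins r
of polynomial length k(|x|) appended to the input, ≤ q(|x|) rounds and query length) such that FOR
EVERY oracle O consistent with Q (O = [true] on Q.yes, [false] on Q.no, ARBITRARY elsewhere) and
every large valid instance, M^O outputs a Good coefficient list with probability ≥ 2/3. CONVENTIONS
(inline): instance (p, F), F : List (List ℕ), F[y-1] = allowed set F_y ⊆ [0,p) for y = 1..p-1;
Valid(P₀): p prime, P₀ ≤ p, F.length = p-1, every row Nodup of length ⌊p/2⌋ with entries < p (JSW's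
balanced case |F_y| = ⌊p/2⌋, m = p-1); n := ⌈p/10⌉ = (p+9)/10 coefficients cs (Q = Σ cs[i] X^i); sat
:= #{j < p-1 : Q(j+1) mod p ∈ F[j]}; Good := cs.length = n ∧ entries < p ∧ 7(p-1) ≤ 10·sat
(threshold 0.70; DQI+BM asymptote 1/2+√19/20 ≈ 0.7179, Prange 0.55); encI p F := boolPair (encodeNat
p) (encodingListNatBool.listBool.encode F); encQ := encodingListNatBool.encode. Candidate M (the
attack): Guruswami–Sudan/Koetter–Vardy LIST-decoding descent fixing top coefficients one at a time
and asking a gappe -/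
@[route_item "route-QuantumAdvantage-CodeCarries", crux]
def OpiLiftPromise : Prop :=
  ∃ Q ∈ Literature.Computability.Cryptography.PromiseBQP, ∃ M : Literature.Computability.Complexity.OracleAlg (List ℕ), M.IsPolyTime Literature.Computability.Complexity.encodingListNatBool ∧ ∃ (q k : Polynomial ℕ) (P₀ : ℕ), ∀ O : Literature.Computability.Complexity.Oracle, (∀ z ∈ Q.yes, O z = Computability.encodeBool true) → (∀ z ∈ Q.no, O z = Computability.encodeBool false) → ∀ (p : ℕ) (F : List (List ℕ)), (p.Prime ∧ P₀ ≤ p ∧ F.length = p - 1 ∧ ∀ S ∈ F, S.Nodup ∧ S.length = p / 2 ∧ ∀ v ∈ S, v < p) → (2 : ℝ) / 3 ≤ Literature.Computability.Complexity.uniformProb (k.eval (Literature.Computability.Complexity.boolPair (Computability.encodeNat p) (Literature.Computability.Complexity.encodingListNatBool.listBool.encode F)).length) {r : List Bool | (∃ cs : List ℕ, M.run O (q.eval (Literature.Computability.Complexity.boolPair (Computability.encodeNat p) (Literature.Computability.Complexity.encodingListNatBool.listBool.encode F)).length) (Literature.Computability.Complexity.boolPair (Literature.Computability.Complexity.boolPair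 (Computability.encodeNat p) (Literature.Computability.Complexity.encodingListNatBool.listBool.encode F)) r) = some cs ∧ cs.length = (p + 9) / 10 ∧ (∀ a ∈ cs, a < p) ∧ 7 * (p - 1) ≤ 10 * ((List.range (p - 1)).filter (fun j => decide ((((List.range cs.length).map (fun i => cs.getD i 0 * (j + 1) ^ i)).sum % p) ∈ F.getD j []))).length) ∧ ∀ z ∈ M.queries O (q.eval (Literature.Computability.Complexity.boolPair (Computability.encodeNat p) (Literature.Computability.Complexity.encodingListNatBool.listBool.encode F)).length) (Literature.Computability.Complexity.boolPair (Literature.Computability.Complexity.boolPair (Computability.encodeNat p) (Literature.Computability.Complexity.encodingListNatBool.listBool.encode F)) r), z.length ≤ q.eval (Literature.Computability.Complexity.boolPair (Computability.encodeNat p) (Literature.Computability.Complexity.encodingListNatBool.listBool.encode F)).length}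

/-- item stmt-QuantumAdvantage-0995 · crux · rank 4 · open · by planner
why it might fail: A classical poly-time 0.7-algorithm for balanced OPI at n~p/10 kills it: no reduction from a standard assumption (JSW Rem 5.2), NP-hardness only at r/q+eps worst case far above DQI's regime (KSE), block-Gibbs MCMC matches DQI in time ~1.1^n (Gil-Fuster+). Unprovable outright (=> P!=NP): refute-only.
sources: arXiv:2408.08292 Rem 5.2 p.12 (classical complexity of OPI: NP99 broken by BN00 lattices in another regime; NP06 assumptions; 'would be very interesting to show OPI classically hard under standard assumptions') + Sec 11 (lattice attacks), arXiv:2607.28120 abstract p.1 + Sec V (MCMC ~1.1^n on OPI in the advantage regime; 'do not refute'), arXiv:2603.04540 pp.2-6 (Kramer-Schubert-Eisert: max-LINSAT(q,r) NP-hard to approximate beyond r/q+eps worst case; OPI is structured, constant n/m, outside the theorem), arXiv:2607.14650 p.1 (Horinaga-Yamakawa: quantum exact OPI for rate>0.75; Sun-Wootters existence) — pressure on the parameter landscape, Naor-Pinkas 1999/2006; Bleichenbacher-Nguyen EUROCRYPT 2000 (noisy polynomial reconstruction attacks)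
[crux] H_OPI, hypothesis-type (refuters: do not staff provers; it is the X-side bet): NO
probabilistic polynomial-time algorithm A : RandAlg (IsPolyTime w.r.t. encI/encQ) achieves, for some
P₀ and every valid instance with p ≥ P₀, probability ≥ 2/3 of outputting a Good coefficient list (≥
7/10 of the p−1 constraints). WORST CASE over instances (the weakest form; the average case over
uniform F_y is the natural strengthening). CONVENTIONS (inline): instance (p, F), F : List (List ℕ),
F[y-1] = allowed set F_y ⊆ [0,p) for y = 1..p-1; Valid(P₀): p prime, P₀ ≤ p, F.length = p-1, every
row Nodup of length ⌊p/2⌋ with entries < p (JSW's balanced case |F_y| = ⌊p/2⌋, m = p-1); n := ⌈p/10⌉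
= (p+9)/10 coefficients cs (Q = Σ cs[i] X^i); sat := #{j < p-1 : Q(j+1) mod p ∈ F[j]}; Good :=
cs.length = n ∧ entries < p ∧ 7(p-1) ≤ 10·sat (threshold 0.70; DQI+BM asymptote 1/2+√19/20 ≈ 0.7179,
Prange 0.55); encI p F := boolPair (encodeNat p) (encodingListNatBool.listBool.encode F); encQ :=
encodingListNatBool.encode. Status: JSW's open challenge — best classical polynomial time is
Prange's 1/2 + n/(2p) = 0.55; lattice (Bleichenbacher–Nguyen) and list-decoding attacks are argued
ineffective in this regime -/
@[route_item "route-QuantumAdvantage-CodeCarries", crux]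
def OpiHard : Prop :=
  ¬ ∃ A : Literature.Computability.Complexity.RandAlg (ℕ × List (List ℕ)) (List ℕ), A.IsPolyTime (fun I : ℕ × List (List ℕ) => Literature.Computability.Complexity.boolPair (Computability.encodeNat I.1) (Literature.Computability.Complexity.encodingListNatBool.listBool.encode I.2)) Literature.Computability.Complexity.encodingListNatBool.encode ∧ ∃ P₀ : ℕ, ∀ (p : ℕ) (F : List (List ℕ)), (p.Prime ∧ P₀ ≤ p ∧ F.length = p - 1 ∧ ∀ S ∈ F, S.Nodup ∧ S.length = p / 2 ∧ ∀ v ∈ S, v < p) → (2 : ℝ) / 3 ≤ A.pr (fun I : ℕ × List (List ℕ) => Literature.Computability.Complexity.boolPair (Computability.encodeNat I.1) (Literature.Computability.Complexity.encodingListNatBool.listBool.encode I.2)) (p, F) {cs : List ℕ | cs.length = (p + 9) / 10 ∧ (∀ a ∈ cs, a < p) ∧ 7 * (p - 1) ≤ 10 * ((List.range (p - 1)).filter (fun j => decide ((((List.range cs.length).map (fun i => cs.getD i 0 * (j + 1) ^ i)).sum % p) ∈ F.getD j []))).length}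

/-- item stmt-QuantumAdvantage-0250 · crux · rank 5 · open · by planner
why it might fail: False iff BQP ⊆ BPP while PromiseBQP ⊄ prBPP' (advantage confined to promise inputs): even the classical analogue 'BPP=P => prBPP=prP' is open (Goldreich 2011 Sec 6), no BQP-complete LANGUAGE is known, and Fortnow-Rogers worlds (P=BQP, PH infinite) are candidate relativized counter-worlds.
sources: Goldreich2011 (doi:10.1007/978-3-642-22670-0_20) Sec 6 open problems + fn 27, AaronsonArkhipov2013 (doi:10.4086/toc.2013.v009a004) Sec 10 open problems (9)-(10): 'P=BQP' vs 'PromiseP=PromiseBQP', Aaronson2010 = arXiv:0910.4698 p.3 (promise problems outside PH while BQP languages inside PH is possible), FortnowRogers1999 = arXiv:cs/9811023 Cor 3.7, arXiv:1009.5104 Sec 1 p.4 (chain of easy implications; converses open)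
OPEN structural question (analogue of 'P = BPP ⇒ prP = prBPP?', Goldreich2011 §1): does equality of
the language classes force equality of the textbook promise classes? The obstruction: a PromiseBQP
family has no acceptance gap off the promise, so its threshold set is not a BQP language. Most
informative crux of the route: a proof makes every PromiseBQP-completeness result (Jones,
Forrelation) a bona fide reformulation of BQP ≠ BPP; a relativized counterexample would explain why
decision-level quantum advantage evidence is scarce. [Goldreich2006 §1.2; Goldreich2011; Watrous2009
§III.2] -/
@[route_item "route-QuantumAdvantage-CodeCarries", crux]
def PlLift : Prop :=
  Literature.Computability.Cryptography.BQP ⊆ Literature.Computability.Complexity.BPP → Literature.Computability.Cryptography.PromiseBQP ⊆ Literature.Computability.Complexity.PromiseBPP'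

/-- item stmt-QuantumAdvantage-0996 · crux · rank 6 · open · by planner
why it might fail: Needs a TOTAL BQP-language oracle: natural sub-instance tests are gapped acceptance-probability estimates; canonical rounding into a language is the pseudo-determinism obstruction (AGL Thm 1.4: D=O~(psQ^5) for total R); exactly computable single DQI output probabilities (MFGH) give only P-languages.
sources: arXiv:2602.17647 Thm 1.4 p.4 (Aaronson-Gur-Li 2026: pseudo-deterministic quantum query algorithms for total problems are emulated deterministically with quintic overhead), arXiv:2509.14443 (Marwaha-Fefferman-Gheorghiu-Havlicek: DQI output probabilities efficiently computable, sampling in BPP^NP, no heavy outputs), arXiv:1009.5104 Sec 4.1 p.11 (search/sampling vs decision equivalence open), arXiv:2607.28120 App D2 (same shortening obstruction as for the promise form)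
[crux] PL-FREE TWIN of the lift: R_OPI(7/10) ∈ FBPP^{L} for some LANGUAGE L ∈ BQP (oracle =
Oracle.ofLanguage L; same transcript/coins conventions as OpiLiftPromise). With OpiHard this gives
the summit DIRECTLY (OpiGlueLang), no PL: if BQP ⊆ BPP the oracle is a BPP language and M becomes a
PPT algorithm. Harder to exhibit than the promise form because the natural branch tests ('does
sub-instance I_a retain DQI-mass ≥ θ') are GAPPED promise problems; a language oracle must be total,
e.g. exact comparisons of P-computable DQI output probabilities (every single DQI output probability
is P-computable, MFGH arXiv:2509.14443) or BQP languages built from amplified estimates with a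
canonical rounding rule. CONVENTIONS (inline): instance (p, F), F : List (List ℕ), F[y-1] = allowed
set F_y ⊆ [0,p) for y = 1..p-1; Valid(P₀): p prime, P₀ ≤ p, F.length = p-1, every row Nodup of
length ⌊p/2⌋ with entries < p (JSW's balanced case |F_y| = ⌊p/2⌋, m = p-1); n := ⌈p/10⌉ = (p+9)/10
coefficients cs (Q = Σ cs[i] X^i); sat := #{j < p-1 : Q(j+1) mod p ∈ F[j]}; Good := cs.length = n ∧
entries < p ∧ 7(p-1) ≤ 10·sat (threshold 0.70; DQI+BM asymptote 1/2+√19/20 ≈ 0.7179, Prange 0.55);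
encI p F := boolPair (en -/
@[route_item "route-QuantumAdvantage-CodeCarries"]
def OpiLiftLang : Prop :=
  ∃ L ∈ Literature.Computability.Cryptography.BQP, ∃ M : Literature.Computability.Complexity.OracleAlg (List ℕ), M.IsPolyTime Literature.Computability.Complexity.encodingListNatBool ∧ ∃ (q k : Polynomial ℕ) (P₀ : ℕ), ∀ (p : ℕ) (F : List (List ℕ)), (p.Prime ∧ P₀ ≤ p ∧ F.length = p - 1 ∧ ∀ S ∈ F, S.Nodup ∧ S.length = p / 2 ∧ ∀ v ∈ S, v < p) → (2 : ℝ) / 3 ≤ Literature.Computability.Complexity.uniformProb (k.eval (Literature.Computability.Complexity.boolPair (Computability.encodeNat p) (Literature.Computability.Complexity.encodingListNatBool.listBool.encode F)).length) {r : List Bool | (∃ cs : List ℕ, M.run (Literature.Computability.Complexity.Oracle.ofLanguage L) (q.eval (Literature.Computability.Complexity.boolPair (Computability.encodeNat p) (Literature.Computability.Complexity.encodingListNatBool.listBool.encode F)).length) (Literature.Computability.Complexity.boolPair (Literature.Computability.Complexity.boolPair (Computability.encodeNat p) (Literature.Computability.Complexity.encodingListNatBool.listBool.encode F)) r) = some cs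 ∧ cs.length = (p + 9) / 10 ∧ (∀ a ∈ cs, a < p) ∧ 7 * (p - 1) ≤ 10 * ((List.range (p - 1)).filter (fun j => decide ((((List.range cs.length).map (fun i => cs.getD i 0 * (j + 1) ^ i)).sum % p) ∈ F.getD j []))).length) ∧ ∀ z ∈ M.queries (Literature.Computability.Complexity.Oracle.ofLanguage L) (q.eval (Literature.Computability.Complexity.boolPair (Computability.encodeNat p) (Literature.Computability.Complexity.encodingListNatBool.listBool.encode F)).length) (Literature.Computability.Complexity.boolPair (Literature.Computability.Complexity.boolPair (Computability.encodeNat p) (Literature.Computability.Complexity.encodingListNatBool.listBool.encode F)) r), z.length ≤ q.eval (Literature.Computability.Complexity.boolPair (Computability.encodeNat p) (Literature.Computability.Complexity.encodingListNatBool.listBool.encode F)).length}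

/-- item stmt-QuantumAdvantage-0994 · support · rank 3 · open · by planner
why it might fail: As typed: finite-size corrections with l <= (n-1)/2 must still clear 0.70 for all p >= P0 (asymptote 0.7179); reversible Berlekamp-Massey + QFT over F_p^n inside uniform Clifford+T; prefix/all-wires output convention and in-family repetition-selection.
sources: arXiv:2408.08292 Thm 4.1, s5, s8, arXiv:2504.18334 (DQI circuits), arXiv:2601.15171 (Rosmanis, near-linear DQI for OPI), arXiv:2607.14650 (Horinaga-Yamakawa)
[crux] THE QUANTUM HALF (theorem-target; the route's missing named fact, filed as a crux so it is
staffed first): ∃ P₀ such that the OPI relation at threshold 7/10 is IsQSolvable — some poly-time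
uniform oracle-free Clifford+T family, run on |x⟩|0…0⟩ and measured on all wires, outputs with
probability ≥ 2/3 a string with prefix encQ cs, Good cs, on every valid instance with p ≥ P₀ (on
strings that encode no valid instance the relation is everything). CONVENTIONS (inline): instance
(p, F), F : List (List ℕ), F[y-1] = allowed set F_y ⊆ [0,p) for y = 1..p-1; Valid(P₀): p prime, P₀ ≤
p, F.length = p-1, every row Nodup of length ⌊p/2⌋ with entries < p (JSW's balanced case |F_y| =
⌊p/2⌋, m = p-1); n := ⌈p/10⌉ = (p+9)/10 coefficients cs (Q = Σ cs[i] X^i); sat := #{j < p-1 : Q(j+1)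
mod p ∈ F[j]}; Good := cs.length = n ∧ entries < p ∧ 7(p-1) ≤ 10·sat (threshold 0.70; DQI+BM
asymptote 1/2+√19/20 ≈ 0.7179, Prange 0.55); encI p F := boolPair (encodeNat p)
(encodingListNatBool.listBool.encode F); encQ := encodingListNatBool.encode. Proof in print: Decoded
Quantum Interferometry (JSW+ arXiv:2408.08292 §3–5): OPI = max-LINSAT with Vandermonde B, C^⊥ =
Reed–Solomon [p-1, p-n-1, n+1]; prepare Σ_Q P -/
@[route_item "route-QuantumAdvantage-CodeCarries"]
def OpiQSolvable : Prop :=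
  ∃ P₀ : ℕ, Literature.Computability.Cryptography.IsQSolvable (fun x => {y : List Bool | ∀ (p : ℕ) (F : List (List ℕ)), (p.Prime ∧ P₀ ≤ p ∧ F.length = p - 1 ∧ ∀ S ∈ F, S.Nodup ∧ S.length = p / 2 ∧ ∀ v ∈ S, v < p) → x = Literature.Computability.Complexity.boolPair (Computability.encodeNat p) (Literature.Computability.Complexity.encodingListNatBool.listBool.encode F) → ∃ cs : List ℕ, Literature.Computability.Complexity.encodingListNatBool.encode cs <+: y ∧ cs.length = (p + 9) / 10 ∧ (∀ a ∈ cs, a < p) ∧ 7 * (p - 1) ≤ 10 * ((List.range (p - 1)).filter (fun j => decide ((((List.range cs.length).map (fun i => cs.getD i 0 * (j + 1) ^ i)).sum % p) ∈ F.getD j []))).length})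

/-- item stmt-QuantumAdvantage-0997 · support · rank 9 · open · by planner
sources: Goldreich2006 s1, AroraBarak2009 s7.4.1
[support] GLUE (provable now; PPT plumbing): OpiHard → OpiLiftPromise → ¬(PromiseBQP ⊆ PromiseBPP′).
If PromiseBQP ⊆ PromiseBPP′, the oracle problem Q has a prBPP decider (L′ ∈ P, coins p′); simulate M
answering each query by the decider amplified to error 2^{-Ω(t)} with fresh coins and MEMOISED
answers (repeated queries answered identically). Conditioned on all promise queries being answered
correctly, the run is M^{O_b} for the consistent oracle O_b given by the lazily sampled off-promise
bits b; M succeeds with probability ≥ 2/3 for every O_b, hence ≥ 2/3 − q·2^{-Ω(t)} on average over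
b; since Good is P-checkable (evaluate Q at p−1 points mod p, |x| ≥ p), run O(1) independent copies
(same memo table = same O_b) and output the first Good answer to push success ≥ 2/3: a PPT algorithm
contradicting OpiHard (with P₀ := max of the two thresholds). Sources: Goldreich 2006 §1 (promise
classes under reductions), Arora–Barak 2009 §7.4.1 (error reduction), Bellare–Goldwasser 1994
(search vs decision). -/
@[route_item "route-QuantumAdvantage-CodeCarries", crux]
def OpiGlue : Prop :=
  OpiHard → OpiLiftPromise → ¬ (Literature.Computability.Cryptography.PromiseBQP ⊆ Literature.Computability.Complexity.PromiseBPP')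

/-- item stmt-QuantumAdvantage-0998 · support · rank 9 · open · by planner
sources: AroraBarak2009 s7.4.1, Literature.Computability.QuantumComplexity.mem_BPP_iff_gill
[support] GLUE for the PL-free twin (provable now): OpiHard → OpiLiftLang → QuantumAdvantage. By
contradiction: if every BQP language is in BPP, the oracle language L of OpiLiftLang is in BPP;
replace each oracle call by an amplified Gill-form BPP decider (error ≤ 1/(3·(q(|x|)+1)) per query
after O(log q) repetitions, union bound over ≤ q(|x|) queries; no promise issue, no memoisation
needed), obtaining a PPT algorithm with success ≥ 2/3 − 1/3·(slack) on all large valid instances;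
re-amplify by repetition + P-checkability of Good to ≥ 2/3, contradicting OpiHard. Hence ¬(BQP ⊆
BPP), i.e. ∃ L ∈ BQP, L ∉ BPP (classical logic). Sources: Arora–Barak 2009 §7.4.1; Bennett–Gill 1981
(BPP^BPP = BPP pattern); tree facts mem_BPP_iff_gill / mem_BPP_iff_randAlg_holds. -/
@[route_item "route-QuantumAdvantage-CodeCarries"]
def OpiGlueLang : Prop :=
  OpiHard → OpiLiftLang → QuantumAdvantage

/-- item stmt-QuantumAdvantage-0999 · assembly · rank 1 · open · by planner
[assembly] OpiHard → OpiLiftPromise → OpiGlue → PlLift → QuantumAdvantage: OpiGlue gives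
¬(PromiseBQP ⊆ PromiseBPP′); PlLift contraposed gives ¬(BQP ⊆ BPP); classically ∃ L ∈ BQP with L ∉
BPP. Pure logic (checked rc 0 with an explicit proof term in the planner's sketch). The PL-free
chain OpiHard → OpiLiftLang → QuantumAdvantage is the support item OpiGlueLang. -/
@[route_item "route-QuantumAdvantage-CodeCarries"]
def Assembly : Prop :=
  OpiHard → OpiLiftPromise → OpiGlue → PlLift → QuantumAdvantage

/-! D-0027 §2.1 — DECIDING THEOREM (planner-authored via `route open/edit --closes-file`; by planner-rbadge-QuantumAdvantage-CodeCarries-9d3c4690-g2-0 2026-08-15T16:12:57Z):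
its hypotheses are this route's items and its conclusion the sub-problem Statement (glue_lint), and it elaborates with this file. -/

@[closes "route-QuantumAdvantage-CodeCarries"] theorem closes (h₁ : OpiHard) (h₂ : OpiLiftPromise) (h₃ : OpiGlue) (h₄ : PlLift) : QuantumAdvantage := by
  by_contra h
  refine h₃ h₁ h₂ (h₄ ?_)
  intro L hL
  by_contra hL'
  exact h ⟨L, hL, hL'⟩

end Summit.QuantumAdvantage.QuantumAdvantage.Theses.CodeCarries
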